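import Literature.NumberTheory.Sieve.GoldstonYildirimLemma21Proofs
import Literature.NumberTheory.Sieve.BombieriVinogradovMoebius
import Literature.NumberTheory.Sieve.SieveFrameworkProofs
import HarnessLib

/-!
# Route `LeeYangFibres`, crux `RelativeDimOne` (stmt-Parity-14113), line `single-moebius-split`:
# helper file 3 for the stub `stub_moebiusTermBV` — the truncated divisor sum along a residue class

For the Goldston–Yıldırım truncation `Λ_R = ∑_{d ∣ ·, d ≤ R} μ(d) log(R/d)` summed over a class
`r (mod Q)` the density of `{v ≡ r (Q) : d ∣ v}` is `[gcd(Q,d) ∣ r] gcd(Q,d)/(Qd)`, so the main term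
is `(length/Q) · 𝔐` with
`𝔐 = ∑_{d ≤ R} μ(d) log(R/d) [gcd(Q,d) ∣ G₀] gcd(Q,d)/d`, `G₀ = gcd(r, Q)`.
`classMainTerm` evaluates `𝔐`: splitting square-free `d = d₁ d₂` with `d₁ = gcd(d, Q) ∣ G₀` and
`(d₂, Q) = 1` (`sum_gcd_split`) gives `𝔐 = ∑_{d₁ ∣ G₀} μ(d₁) ∑_{d₂ ≤ R/d₁, (d₂,Q)=1} μ(d₂) log((R/d₁)/d₂)/d₂`,
and the inner sums are `Q/φ(Q) + O(e^{-c√log(R/d₁)})` by the tree's PROVED Goldston–Yıldırım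
Lemma 2.1 (`Literature.NumberTheory.Sieve.goldstonYildirim_lemma21_log_j0_holds`); since
`∑_{d₁ ∣ G₀} μ(d₁) = [G₀ = 1]`, `𝔐 = [G₀ = 1] Q/φ(Q) + O(τ(G₀) e^{-c√log(R/G₀)})` uniformly for
`Q ≤ R/G₀` — exactly the main term `length/φ(Q)` of the primes in the class when the class is
reduced, and NO main term otherwise.

References: D. A. Goldston, C. Y. Yıldırım, *Higher correlations of divisor sums related to primes
I: triple correlations*, Integers 3 (2003) A5, Lemma 2.1 [GoldstonYildirim2001].
-/

noncomputable section

open Finset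
open scoped ArithmeticFunction.Moebius

namespace Summit.Parity.GeneralizedHardyLittlewood.Cruxes.RelativeDimOne.SingleMoebiusSplit

open Literature.NumberTheory.Sieve (goldstonYildirim_lemma21_log_j0_holds sum_divisors_moebius_real)

/-- **Splitting off the part of a square-free modulus inside `Q`.** For `Q ≥ 1`, `G₀ ∣ Q`, `R ≥ 0`:
`∑_{d ≤ R} μ(d) log(R/d) [gcd(Q,d) ∣ G₀] gcd(Q,d)/d = ∑_{d₁ ∣ G₀} μ(d₁) ∑_{d₂ ≤ R/d₁, (d₂,Q)=1} μ(d₂)/d₂ · log((R/d₁)/d₂)`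
(square-free `d ↔ (d₁, d₂) = (gcd(d,Q), d/gcd(d,Q))`; `μ` kills the rest). [folklore] -/
theorem sum_gcd_split {Q G₀ : ℕ} (hQ : 0 < Q) (hG₀ : G₀ ∣ Q) {R : ℝ} (hR : 0 ≤ R) :
    ∑ d ∈ Icc 1 ⌊R⌋₊, (μ d : ℝ) * Real.log (R / d) *
        (if Nat.gcd Q d ∣ G₀ then (Nat.gcd Q d : ℝ) / d else 0) =
      ∑ d₁ ∈ G₀.divisors, (μ d₁ : ℝ) *
        ∑ d₂ ∈ (Icc 1 ⌊R / d₁⌋₊).filter (fun d₂ => Nat.Coprime d₂ Q),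
          (μ d₂ : ℝ) / d₂ * Real.log (R / d₁ / d₂) := by
  classical
  have hG₀0 : G₀ ≠ 0 := fun h => by rw [h, zero_dvd_iff] at hG₀; omega
  -- restrict the left side to square-free `d` with `gcd(Q, d) ∣ G₀`
  have hL : ∑ d ∈ Icc 1 ⌊R⌋₊, (μ d : ℝ) * Real.log (R / d) *
      (if Nat.gcd Q d ∣ G₀ then (Nat.gcd Q d : ℝ) / d else 0) =
      ∑ d ∈ (Icc 1 ⌊R⌋₊).filter (fun d => Squarefree d ∧ Nat.gcd Q d ∣ G₀),
        (μ d : ℝ) * Real.log (R / d) * ((Nat.gcd Q d : ℝ) / d) := by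
    rw [← Finset.sum_filter_of_ne (p := fun d => Squarefree d ∧ Nat.gcd Q d ∣ G₀)]
    · refine Finset.sum_congr rfl fun d hd => ?_
      rw [if_pos (Finset.mem_filter.1 hd).2.2]
    · intro d _ hne
      refine ⟨?_, ?_⟩
      · by_contra hsq
        apply hne
        rw [ArithmeticFunction.moebius_eq_zero_of_not_squarefree hsq]
        simp
      · by_contra hdiv
        apply hne
        rw [if_neg hdiv, mul_zero]
  -- the right side as a sum over pairs, restricted to square-free pairs
  have hRt : ∑ d₁ ∈ G₀.divisors, (μ d₁ : ℝ) *
      ∑ d₂ ∈ (Icc 1 ⌊R / d₁⌋₊).filter (fun d₂ => Nat.Coprime d₂ Q),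
        (μ d₂ : ℝ) / d₂ * Real.log (R / d₁ / d₂) =
      ∑ x ∈ (G₀.divisors.sigma (fun d₁ => (Icc 1 ⌊R / d₁⌋₊).filter (fun d₂ => Nat.Coprime d₂ Q))).filter
          (fun x => Squarefree x.1 ∧ Squarefree x.2),
        (μ x.1 : ℝ) * ((μ x.2 : ℝ) / x.2 * Real.log (R / x.1 / x.2)) := by
    simp_rw [Finset.mul_sum]
    rw [Finset.sum_sigma',
      ← Finset.sum_filter_of_ne (p := fun x : (Σ _ : ℕ, ℕ) => Squarefree x.1 ∧ Squarefree x.2)]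
    intro x _ hne
    refine ⟨?_, ?_⟩
    · by_contra hsq
      apply hne
      rw [ArithmeticFunction.moebius_eq_zero_of_not_squarefree hsq]
      simp
    · by_contra hsq
      apply hne
      rw [ArithmeticFunction.moebius_eq_zero_of_not_squarefree hsq]
      simp
  rw [hL, hRt]
  -- the bijection `d ↦ (gcd(d, Q), d / gcd(d, Q))`
  refine Finset.sum_nbij' (fun d => ⟨Nat.gcd d Q, d / Nat.gcd d Q⟩) (fun x => x.1 * x.2)
    (fun d hd => ?_) (fun x hx => ?_) (fun d hd => ?_) (fun x hx => ?_) (fun d hd => ?_)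
  · -- lands in the set of pairs
    rw [Finset.mem_filter, Finset.mem_Icc] at hd
    obtain ⟨⟨hd1, hdR⟩, hsq, hdiv⟩ := hd
    set g := Nat.gcd d Q with hg
    have hg0 : 0 < g := Nat.gcd_pos_of_pos_left _ hd1
    have hgd : g ∣ d := Nat.gcd_dvd_left _ _
    have hdg : d = g * (d / g) := (Nat.mul_div_cancel' hgd).symm
    have hsq' := Nat.squarefree_mul_iff.1 (hdg ▸ hsq)
    have hcop : Nat.Coprime (d / g) Q := by
      rw [Nat.coprime_iff_gcd_eq_one]
      have h1 : Nat.gcd (d / g) Q ∣ g := by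
        rw [hg]; exact Nat.gcd_dvd_gcd_of_dvd_left _ (Nat.div_dvd_of_dvd hgd)
      have h2 : Nat.gcd (d / g) Q ∣ d / g := Nat.gcd_dvd_left _ _
      have h3 : Nat.gcd (d / g) Q ∣ Nat.gcd g (d / g) := Nat.dvd_gcd h1 h2
      rw [Nat.coprime_iff_gcd_eq_one.1 hsq'.1] at h3
      exact Nat.dvd_one.1 h3
    rw [Finset.mem_filter, Finset.mem_sigma]
    refine ⟨⟨Nat.mem_divisors.2 ⟨by rw [hg, Nat.gcd_comm]; exact hdiv, hG₀0⟩, ?_⟩, hsq'.2.1, hsq'.2.2⟩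
    rw [Finset.mem_filter, Finset.mem_Icc]
    refine ⟨⟨Nat.div_pos (Nat.le_of_dvd hd1 hgd) hg0, Nat.le_floor ?_⟩, hcop⟩
    have hg0' : (0 : ℝ) < g := by exact_mod_cast hg0
    rw [le_div_iff₀ hg0']
    have : ((d / g : ℕ) : ℝ) * g = d := by exact_mod_cast Nat.div_mul_cancel hgd
    rw [this]
    exact le_trans (by exact_mod_cast hdR) (Nat.floor_le hR)
  · -- comes from a square-free `d`
    rw [Finset.mem_filter, Finset.mem_sigma, Finset.mem_filter, Finset.mem_Icc,
      Nat.mem_divisors] at hx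
    obtain ⟨⟨⟨h1G, -⟩, ⟨h21, h2R⟩, hcop⟩, hsq1, hsq2⟩ := hx
    have h1Q : x.1 ∣ Q := dvd_trans h1G hG₀
    have h10 : 0 < x.1 := Nat.pos_of_dvd_of_pos h1Q hQ
    have hcop12 : Nat.Coprime x.1 x.2 := by
      rw [Nat.coprime_iff_gcd_eq_one]
      have h1 : Nat.gcd x.1 x.2 ∣ Nat.gcd x.2 Q :=
        Nat.dvd_gcd (Nat.gcd_dvd_right _ _) (dvd_trans (Nat.gcd_dvd_left _ _) h1Q)
      rw [Nat.coprime_iff_gcd_eq_one.1 hcop] at h1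
      exact Nat.dvd_one.1 h1
    have hgcd : Nat.gcd Q (x.1 * x.2) = x.1 := by
      rw [Nat.Coprime.gcd_mul _ hcop12, Nat.gcd_eq_right h1Q,
        Nat.coprime_iff_gcd_eq_one.1 (Nat.coprime_comm.1 hcop), mul_one]
    rw [Finset.mem_filter, Finset.mem_Icc]
    refine ⟨⟨Nat.mul_pos h10 h21, Nat.le_floor ?_⟩, Nat.squarefree_mul_iff.2 ⟨hcop12, hsq1, hsq2⟩,
      by rw [hgcd]; exact h1G⟩
    have h10' : (0 : ℝ) < x.1 := by exact_mod_cast h10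
    have h2R' : (x.2 : ℝ) ≤ R / x.1 := le_trans (by exact_mod_cast h2R) (Nat.floor_le (by positivity))
    rw [le_div_iff₀ h10'] at h2R'
    push_cast
    linarith
  · -- left inverse
    exact Nat.mul_div_cancel' (Nat.gcd_dvd_left _ _)
  · -- right inverse
    rw [Finset.mem_filter, Finset.mem_sigma, Finset.mem_filter, Nat.mem_divisors] at hx
    obtain ⟨⟨⟨h1G, -⟩, -, hcop⟩, -, -⟩ := hx
    have h1Q : x.1 ∣ Q := dvd_trans h1G hG₀
    have h10 : 0 < x.1 := Nat.pos_of_dvd_of_pos h1Q hQ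
    have hcop12 : Nat.Coprime x.1 x.2 := by
      rw [Nat.coprime_iff_gcd_eq_one]
      have h1 : Nat.gcd x.1 x.2 ∣ Nat.gcd x.2 Q :=
        Nat.dvd_gcd (Nat.gcd_dvd_right _ _) (dvd_trans (Nat.gcd_dvd_left _ _) h1Q)
      rw [Nat.coprime_iff_gcd_eq_one.1 hcop] at h1
      exact Nat.dvd_one.1 h1
    have hgcd : Nat.gcd (x.1 * x.2) Q = x.1 := by
      rw [Nat.gcd_comm, Nat.Coprime.gcd_mul _ hcop12, Nat.gcd_eq_right h1Q,
        Nat.coprime_iff_gcd_eq_one.1 (Nat.coprime_comm.1 hcop), mul_one]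
    refine Sigma.ext hgcd (heq_of_eq ?_)
    change x.1 * x.2 / Nat.gcd (x.1 * x.2) Q = x.2
    rw [hgcd, Nat.mul_div_cancel_left _ h10]
  · -- the summands agree
    rw [Finset.mem_filter, Finset.mem_Icc] at hd
    obtain ⟨⟨hd1, -⟩, hsq, -⟩ := hd
    set g := Nat.gcd d Q with hg
    have hg0 : 0 < g := Nat.gcd_pos_of_pos_left _ hd1
    have hgd : g ∣ d := Nat.gcd_dvd_left _ _
    have hdg : d = g * (d / g) := (Nat.mul_div_cancel' hgd).symm
    have hsq' := Nat.squarefree_mul_iff.1 (hdg ▸ hsq)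
    have hμ : (μ d : ℝ) = (μ g : ℝ) * (μ (d / g) : ℝ) := by
      conv_lhs => rw [hdg]
      rw [ArithmeticFunction.isMultiplicative_moebius.map_mul_of_coprime hsq'.1]
      push_cast; ring
    have hgQ : Nat.gcd Q d = g := by rw [hg, Nat.gcd_comm]
    have hg0' : (0 : ℝ) < g := by exact_mod_cast hg0
    have hd0' : (0 : ℝ) < (d / g : ℕ) := by
      exact_mod_cast Nat.div_pos (Nat.le_of_dvd hd1 hgd) hg0
    have hdr : (d : ℝ) = (g : ℝ) * (d / g : ℕ) := by exact_mod_cast hdg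
    change (μ d : ℝ) * Real.log (R / d) * ((Nat.gcd Q d : ℝ) / d) =
      (μ g : ℝ) * ((μ (d / g) : ℝ) / (d / g : ℕ) * Real.log (R / g / (d / g : ℕ)))
    rw [hgQ, hμ, hdr, div_div]
    field_simp

/-- **The truncated divisor sum along a residue class: main term.** There are `c > 0`, `C ≥ 0` such
that for all `Q ≥ 1`, `G₀ ∣ Q`, and `R ≥ Rmin · G₀` with `Rmin ≥ max(1, Q)`:
`|∑_{d ≤ R} μ(d) log(R/d) [gcd(Q,d) ∣ G₀] gcd(Q,d)/d − [G₀ = 1] Q/φ(Q)| ≤ C τ(G₀) exp(−c √log Rmin)`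
(Goldston–Yıldırım Lemma 2.1 at `j = 0` with the coprimality condition, applied at `R/d₁` for each
`d₁ ∣ G₀`, and `∑_{d₁ ∣ G₀} μ(d₁) = [G₀ = 1]`). [cite: GoldstonYildirim2001, Lemma 2.1] -/
theorem classMainTerm : ∃ c C : ℝ, 0 < c ∧ 0 ≤ C ∧ ∀ (Q : ℕ), 0 < Q → ∀ (G₀ : ℕ), G₀ ∣ Q → ∀ (R Rmin : ℝ), 1 ≤ Rmin → Rmin * G₀ ≤ R → (Q : ℝ) ≤ Rmin → |(∑ d ∈ Finset.Icc 1 ⌊R⌋₊, ((ArithmeticFunction.moebius d : ℤ) : ℝ) * Real.log (R / d) * (if Nat.gcd Q d ∣ G₀ then (Nat.gcd Q d : ℝ) / d else 0)) - (if G₀ = 1 then (Q : ℝ) / Nat.totient Q else 0)| ≤ C * G₀.divisors.card * Real.exp (-c * Real.sqrt (Real.log Rmin)) := by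
  classical
  obtain ⟨c, hc, hGY⟩ := goldstonYildirim_lemma21_log_j0_holds
  obtain ⟨C, hC⟩ := hGY 1 one_pos
  refine ⟨c, max C 0, hc, le_max_right _ _, ?_⟩
  intro Q hQ G₀ hG₀ R Rmin hRmin hRG hQR
  have hG₀0 : G₀ ≠ 0 := fun h => by rw [h, zero_dvd_iff] at hG₀; omega
  have hG₀1 : (1 : ℝ) ≤ G₀ := by exact_mod_cast Nat.pos_of_ne_zero hG₀0
  have hR1 : Rmin ≤ R := le_trans (by nlinarith) hRG
  have hR0 : 0 ≤ R := by linarith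
  rw [sum_gcd_split hQ hG₀ hR0]
  -- the main term `∑_{d₁ ∣ G₀} μ(d₁) · Q/φ(Q) = [G₀ = 1] Q/φ(Q)`
  have hmain : (if G₀ = 1 then (Q : ℝ) / Nat.totient Q else 0) =
      ∑ d₁ ∈ G₀.divisors, (μ d₁ : ℝ) * ((Q : ℝ) / Nat.totient Q) := by
    rw [← Finset.sum_mul, sum_divisors_moebius_real]
    split_ifs <;> simp
  rw [hmain, ← Finset.sum_sub_distrib]
  -- each inner sum is `Q/φ(Q) + O(e^{-c √log(R/d₁)})`
  have hterm : ∀ d₁ ∈ G₀.divisors,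
      |(μ d₁ : ℝ) * ∑ d₂ ∈ (Icc 1 ⌊R / d₁⌋₊).filter (fun d₂ => Nat.Coprime d₂ Q),
          (μ d₂ : ℝ) / d₂ * Real.log (R / d₁ / d₂) - (μ d₁ : ℝ) * ((Q : ℝ) / Nat.totient Q)| ≤
        max C 0 * Real.exp (-c * Real.sqrt (Real.log Rmin)) := by
    intro d₁ hd₁
    rw [Nat.mem_divisors] at hd₁
    have hd₁0 : 0 < d₁ := Nat.pos_of_dvd_of_pos hd₁.1 (Nat.pos_of_ne_zero hG₀0)
    have hd₁G : (d₁ : ℝ) ≤ G₀ := by exact_mod_cast Nat.le_of_dvd (Nat.pos_of_ne_zero hG₀0) hd₁.1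
    have hd₁0' : (0 : ℝ) < d₁ := by exact_mod_cast hd₁0
    -- `R/d₁ ≥ Rmin ≥ 1` and `Q ≤ (R/d₁)^1`
    have hR' : Rmin ≤ R / d₁ := by
      rw [le_div_iff₀ hd₁0']
      nlinarith
    have hR'1 : 1 ≤ R / d₁ := le_trans hRmin hR'
    have hQR' : (Q : ℝ) ≤ (R / d₁) ^ (1 : ℝ) := by rw [Real.rpow_one]; exact le_trans hQR hR'
    have h := hC Q hQ (R / d₁) hR'1 hQR'
    have hμ1 : |(μ d₁ : ℝ)| ≤ 1 := by exact_mod_cast ArithmeticFunction.abs_moebius_le_one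
    rw [← mul_sub, abs_mul]
    have hexp : Real.exp (-c * Real.sqrt (Real.log (R / d₁))) ≤
        Real.exp (-c * Real.sqrt (Real.log Rmin)) := by
      refine Real.exp_le_exp.2 ?_
      have : Real.sqrt (Real.log Rmin) ≤ Real.sqrt (Real.log (R / d₁)) :=
        Real.sqrt_le_sqrt (Real.log_le_log (by linarith) hR')
      nlinarith
    have hE0 : 0 ≤ Real.exp (-c * Real.sqrt (Real.log Rmin)) := (Real.exp_pos _).le
    calc |(μ d₁ : ℝ)| * |∑ d₂ ∈ (Icc 1 ⌊R / d₁⌋₊).filter (fun d₂ => Nat.Coprime d₂ Q),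
            (μ d₂ : ℝ) / d₂ * Real.log (R / d₁ / d₂) - (Q : ℝ) / Nat.totient Q|
        ≤ 1 * (C * Real.exp (-c * Real.sqrt (Real.log (R / d₁)))) :=
          mul_le_mul hμ1 h (abs_nonneg _) zero_le_one
      _ ≤ max C 0 * Real.exp (-c * Real.sqrt (Real.log Rmin)) := by
          rw [one_mul]
          calc C * Real.exp (-c * Real.sqrt (Real.log (R / d₁)))
              ≤ max C 0 * Real.exp (-c * Real.sqrt (Real.log (R / d₁))) :=
                mul_le_mul_of_nonneg_right (le_max_left _ _) (Real.exp_pos _).le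
            _ ≤ max C 0 * Real.exp (-c * Real.sqrt (Real.log Rmin)) :=
                mul_le_mul_of_nonneg_left hexp (le_max_right _ _)
  calc |∑ d₁ ∈ G₀.divisors, ((μ d₁ : ℝ) * ∑ d₂ ∈ (Icc 1 ⌊R / d₁⌋₊).filter (fun d₂ => Nat.Coprime d₂ Q),
          (μ d₂ : ℝ) / d₂ * Real.log (R / d₁ / d₂) - (μ d₁ : ℝ) * ((Q : ℝ) / Nat.totient Q))|
      ≤ ∑ d₁ ∈ G₀.divisors, |(μ d₁ : ℝ) * ∑ d₂ ∈ (Icc 1 ⌊R / d₁⌋₊).filter (fun d₂ => Nat.Coprime d₂ Q),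
          (μ d₂ : ℝ) / d₂ * Real.log (R / d₁ / d₂) - (μ d₁ : ℝ) * ((Q : ℝ) / Nat.totient Q)| :=
        Finset.abs_sum_le_sum_abs _ _
    _ ≤ ∑ _d₁ ∈ G₀.divisors, max C 0 * Real.exp (-c * Real.sqrt (Real.log Rmin)) :=
        Finset.sum_le_sum hterm
    _ = max C 0 * G₀.divisors.card * Real.exp (-c * Real.sqrt (Real.log Rmin)) := by
        rw [Finset.sum_const, nsmul_eq_mul]; ring

end Summit.Parity.GeneralizedHardyLittlewood.Cruxes.RelativeDimOne.SingleMoebiusSplit
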